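import Summits.Parity.GeneralizedHardyLittlewood.Theses.LiouvilleShiftedTables
import Summits.Parity.GeneralizedHardyLittlewood.Theorems.TableChowla.Negative.TableChowlaEveryLevelFaces
import Summits.Parity.GeneralizedHardyLittlewood.Theorems.LiouvilleShiftedTablesLargeDilatedTableChowla
import Summits.Parity.GeneralizedHardyLittlewood.Theorems.LiouvilleShiftedTablesSieveToMAvgMain

/-!
# STRATEGY-CENSUS companion r1 — crux `DilatedTableChowla` (stmt-Parity-14271), second opinion

Typed objects behind `Cruxes/DilatedTableChowla/STRATEGY-CENSUS.md` Part I (planner-cstrat-stmt-Parity-14271-r1-0,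
2026-08-17).  Nothing here concludes the crux and nothing is a line: no `stub_*`, no `DilatedTableChowla_of`,
no `sorry`.  Every theorem is a composition of LANDED `Theorems/*` results or elementary bookkeeping.

* §1 `floors`, `floor_level_eleven_twelfths` — the certificate the tribunal needs BY NAME: any proof of the crux
  proves (F1) fixed-residue `|·|`-level of distribution `θ` for `λ` at EVERY `θ ∈ [7/12, 1)` (in particular
  at `θ = 11/12`) with every log-power saving, and (F2) the dilation-averaged fixed-shift `μ`–`λ` face.
* §2 `FixedResidueLevelOn` — F1 restricted to a modulus family (`x^η`-smooth moduli = the Zhang/Polymath-8a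
  shape; conveniently factorable moduli = the Maynard-III shape; prime moduli = Green 2016): the crux gives
  every restricted face (`crux_gives_restricted_face`); print gives ONLY restricted faces, at levels
  `≤ 1/2 + 7/300`, and no restricted face implies the unrestricted one (positive-density complement) — the
  typed form of the Transfer break points T6–T8 of the census.
* §2b D5 — `OpNormPeriodicShortSide m ∧ OpNormBalancedShortSide m`, the test-vector-class split of the
  operator-norm form (pieces proved from the crux; neither piece separates F1 from F2).
* §3 `ConsumedDilatedTableChowla` — what the deciding theorem ACTUALLY consumes of X1: one exponent
  `C₀ = 4·16421`, negative shifts `c ≤ −1` only, `δ = min(ρ/4, 1/12)` with `ρ` from `TypeI2Dilated`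
  (read off `Theorems.SieveToMAvg.core_of_cruxes`); `mavg_of_consumed` re-runs the landed glue from this
  weaker hypothesis (so the `∀ C` and the positive shifts of X1 are decoration w.r.t. `closes`), and
  `consumed_of_crux` is the trivial direction.  Informational only: the consumed form still contains F1 at the
  fixed exponent `C₀/4 − 1` and every level in `[2/3 − δ, 1 − δ]`, which is equally beyond print.
-/

namespace Summit.Parity.GeneralizedHardyLittlewood.Cruxes.DilatedTableChowla.StrategyCensusR1

open Finset Real Filter Asymptotics
open scoped Classical
open Summit.Parity.GeneralizedHardyLittlewood.Theses.LiouvilleShiftedTables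
open Summit.Parity.GeneralizedHardyLittlewood
open Summit.Parity.GeneralizedHardyLittlewood.Theorems.TableChowla.Negative (FixedResidueLevel MuDilationFace
  colSum lam fixedResidueLevel_of_tableChowla muDilationFace_of_tableChowla)

noncomputable section

/-! ## §1 The floors, bundled (certificate for the tribunal) -/

/-- **FLOORS of every concluding skeleton.** `DilatedTableChowla` implies (F1) `FixedResidueLevel θ` for every
`θ ∈ [7/12, 1)` — fixed residue `c`, absolute values over the moduli `b ≤ x^θ`, segments of `x^{1−θ}` terms,
every log-power saving: the `λ`-analogue of the fixed-residue Elliott–Halberstam statement at every level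
below `1` — and (F2) `MuDilationFace`, the dilation-averaged fixed-shift binary `μ`–`λ` correlation bound with
every log-power saving.  Composition of `Theorems.LargeDilatedTableChowla.dilatedTableChowla_iff_table_and_item`
(p88402) with `Theorems.TableChowla.Negative.fixedResidueLevel_of_tableChowla` /
`muDilationFace_of_tableChowla` (landed). -/
theorem floors (h : DilatedTableChowla) :
    (∀ θ : ℝ, 7 / 12 ≤ θ → θ < 1 → FixedResidueLevel θ) ∧ MuDilationFace := by
  have hT : TableChowla :=
    (Theorems.LargeDilatedTableChowla.dilatedTableChowla_iff_table_and_item.mp h).1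
  exact ⟨fun θ hθ hθ' => fixedResidueLevel_of_tableChowla hT hθ hθ',
    muDilationFace_of_tableChowla hT⟩

/-- The top of the window at `δ = 1/12`: fixed-residue `|·|`-level `11/12` for `λ` (moduli `b ≤ x^{11/12}`,
progressions of `x^{1/12}` terms), every log power. -/
theorem floor_level_eleven_twelfths (h : DilatedTableChowla) : FixedResidueLevel (11 / 12) :=
  (floors h).1 _ (by norm_num) (by norm_num)

/-- The bottom of the window (the EASIEST level the crux ever asks): `7/12 > 4/7 > 1/2 + 7/300`. -/
theorem floor_level_seven_twelfths (h : DilatedTableChowla) : FixedResidueLevel (7 / 12) :=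
  (floors h).1 _ (by norm_num) (by norm_num)

example : (4 : ℝ) / 7 < 7 / 12 ∧ (1 : ℝ) / 2 + 7 / 300 < 4 / 7 ∧ (1 : ℝ) / 2 + 1 / 78 < 1 / 2 + 7 / 300 := by
  norm_num

/-! ## §2 Restricted faces: what print gives is a sub-face of F1, never conversely -/

/-- F1 restricted to the moduli `b` satisfying `P x b`. -/
def FixedResidueLevelOn (θ : ℝ) (P : ℝ → ℕ → Prop) : Prop :=
  ∀ c : ℤ, c ≠ 0 → ∀ C : ℝ, 0 < C → ∃ x₀ : ℝ, ∀ x : ℝ, x₀ ≤ x →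
    (∑ b ∈ (Icc 1 ⌊x / x ^ (1 - θ)⌋₊).filter (fun b => P x b),
        |colSum lam c ⌊x ^ (1 - θ)⌋₊ ⌊2 * x ^ (1 - θ)⌋₊ b|) ≤ x / Real.log x ^ C

/-- Dropping moduli only drops non-negative terms. -/
theorem fixedResidueLevelOn_of_fixedResidueLevel {θ : ℝ} (h : FixedResidueLevel θ) (P : ℝ → ℕ → Prop) :
    FixedResidueLevelOn θ P := by
  intro c hc C hC
  obtain ⟨x₀, hx₀⟩ := h c hc C hC
  refine ⟨x₀, fun x hx => le_trans ?_ (hx₀ x hx)⟩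
  exact Finset.sum_le_sum_of_subset_of_nonneg (Finset.filter_subset _ _) (fun b _ _ => abs_nonneg _)

/-- T6 (Zhang / Polymath 8a shape): `x^η`-smooth moduli. -/
def SmoothModulus (η : ℝ) (x : ℝ) (b : ℕ) : Prop :=
  ∀ p : ℕ, p.Prime → p ∣ b → (p : ℝ) ≤ x ^ η

/-- T7 (Maynard III shape): conveniently factorable moduli — a divisor in `[x^{σ₁}, x^{σ₂}]`. -/
def FactorableModulus (σ₁ σ₂ : ℝ) (x : ℝ) (b : ℕ) : Prop :=
  ∃ d : ℕ, d ∣ b ∧ x ^ σ₁ ≤ (d : ℝ) ∧ (d : ℝ) ≤ x ^ σ₂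

/-- T8 (Green 2016 shape): prime moduli. -/
def PrimeModulus (_x : ℝ) (b : ℕ) : Prop := b.Prime

/-- The crux gives EVERY restricted face at EVERY level in `[7/12, 1)`.  (Print gives: smooth moduli at
levels `≤ 1/2 + 7/300`, factorable moduli at `≤ 1/2 + 1/1000`, prime moduli at `≤ 1/2 + 1/78` with an
`ε`-saving — for `Λ` resp. bounded multiplicative `f`; none of the three families is co-null among the
moduli `b ≤ x^θ`, so no restricted face gives back `FixedResidueLevel θ`.) -/
theorem crux_gives_restricted_face (h : DilatedTableChowla) (P : ℝ → ℕ → Prop) {θ : ℝ}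
    (hθ : 7 / 12 ≤ θ) (hθ' : θ < 1) : FixedResidueLevelOn θ P :=
  fixedResidueLevelOn_of_fixedResidueLevel ((floors h).1 θ hθ hθ') P

example (h : DilatedTableChowla) (η : ℝ) : FixedResidueLevelOn (11 / 12) (SmoothModulus η) :=
  crux_gives_restricted_face h _ (by norm_num) (by norm_num)

example (h : DilatedTableChowla) (σ₁ σ₂ : ℝ) : FixedResidueLevelOn (11 / 12) (FactorableModulus σ₁ σ₂) :=
  crux_gives_restricted_face h _ (by norm_num) (by norm_num)

example (h : DilatedTableChowla) : FixedResidueLevelOn (11 / 12) PrimeModulus :=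
  crux_gives_restricted_face h _ (by norm_num) (by norm_num)

/-! ## §2b Decomposition D5 — split of the operator-norm form by the CLASS of the short-side test vector

`OperatorNormForm ↔ TableChowla` is landed (`Theorems.TableChowla.Negative.operatorNormForm_iff`).  Every unit
`u` on the rows splits orthogonally as `u = E_m u + (u − E_m u)` (`E_m` = averaging over the classes mod `m`
inside the row range, an orthogonal projection), so `OpNormPeriodicShortSide m ∧ OpNormBalancedShortSide m`
gives the operator-norm inequality with an extra factor `2` (absorbed by `C ↦ C + 1`, `log x ≥ 2`), hence the
crux's `q = 1` slice; conversely both pieces are restrictions of `OperatorNormForm` (`pieces_of_operatorNormForm`,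
proved).  Which piece is the whole crux: piece 1 at `m = 1` (constant `u`, arbitrary `v`) is EXACTLY the F1 test
pair (`u = 𝟙/√rows`, `v = sign ∘ colSum/√cols`), so piece 1 ⊇ `FixedResidueLevel θ ∀θ`; piece 2 contains the
two-point faces (`u ≈ λ` restricted to the rows is balanced on small classes by Siegel–Walfisz) AND, for `u`
periodic at a larger period `m' ∤ m`, `m' ≤ 2A`, one-point faces at moduli `m'b` beyond level `1/2` again; and
"balanced at every period `≤ 2A`" forces `u = 0`.  No linear decomposition of the short-side unit ball separates
the EH_λ content (F1) from the Chowla–Elliott content (F2): both pieces are conjecture-grade for every `m`. -/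

/-- D5 piece 1: the operator-norm inequality for short-side test vectors that are `m`-PERIODIC on the rows. -/
def OpNormPeriodicShortSide (m : ℕ) : Prop :=
  ∀ c : ℤ, c ≠ 0 → ∀ δ : ℝ, 0 < δ → δ ≤ 1 / 12 → ∀ C : ℝ, 0 < C → ∃ x₀ : ℝ, ∀ x : ℝ, x₀ ≤ x →
    ∀ A : ℝ, x ^ δ ≤ A → A ≤ x ^ (1 / 3 + δ) →
    ∀ u v : ℕ → ℝ, (∀ a a' : ℕ, a % m = a' % m → u a = u a') →
      (∑ a ∈ Finset.Ioc ⌊A⌋₊ ⌊2 * A⌋₊, u a ^ 2 ≤ 1) → (∑ b ∈ Finset.Icc 1 ⌊x / A⌋₊, v b ^ 2 ≤ 1) →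
      |∑ a ∈ Finset.Ioc ⌊A⌋₊ ⌊2 * A⌋₊, ∑ b ∈ Finset.Icc 1 ⌊x / A⌋₊,
          u a * v b * Theorems.TableChowla.Negative.entry c a b| ≤ x ^ (1 / 2 : ℝ) / Real.log x ^ C

/-- D5 piece 2: the operator-norm inequality for short-side test vectors BALANCED on every class mod `m`. -/
def OpNormBalancedShortSide (m : ℕ) : Prop :=
  ∀ c : ℤ, c ≠ 0 → ∀ δ : ℝ, 0 < δ → δ ≤ 1 / 12 → ∀ C : ℝ, 0 < C → ∃ x₀ : ℝ, ∀ x : ℝ, x₀ ≤ x →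
    ∀ A : ℝ, x ^ δ ≤ A → A ≤ x ^ (1 / 3 + δ) →
    ∀ u v : ℕ → ℝ, (∀ r : ℕ, (∑ a ∈ (Finset.Ioc ⌊A⌋₊ ⌊2 * A⌋₊).filter (fun a => a % m = r), u a) = 0) →
      (∑ a ∈ Finset.Ioc ⌊A⌋₊ ⌊2 * A⌋₊, u a ^ 2 ≤ 1) → (∑ b ∈ Finset.Icc 1 ⌊x / A⌋₊, v b ^ 2 ≤ 1) →
      |∑ a ∈ Finset.Ioc ⌊A⌋₊ ⌊2 * A⌋₊, ∑ b ∈ Finset.Icc 1 ⌊x / A⌋₊,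
          u a * v b * Theorems.TableChowla.Negative.entry c a b| ≤ x ^ (1 / 2 : ℝ) / Real.log x ^ C

/-- Both D5 pieces are restrictions of the operator-norm form of the crux's `q = 1` slice (so the split loses
nothing in this direction; the converse carries a harmless factor `2`, see the section docstring). -/
theorem pieces_of_operatorNormForm (h : Theorems.TableChowla.Negative.OperatorNormForm) (m : ℕ) :
    OpNormPeriodicShortSide m ∧ OpNormBalancedShortSide m := by
  constructor
  · intro c hc δ hδ hδ' C hC
    obtain ⟨x₀, hx₀⟩ := h c hc δ hδ hδ' C hC
    exact ⟨x₀, fun x hx A hA hA' u v _ hu hv => hx₀ x hx A hA hA' u v hu hv⟩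
  · intro c hc δ hδ hδ' C hC
    obtain ⟨x₀, hx₀⟩ := h c hc δ hδ hδ' C hC
    exact ⟨x₀, fun x hx A hA hA' u v _ hu hv => hx₀ x hx A hA hA' u v hu hv⟩

/-- Hence the crux gives both pieces, for every period `m`. -/
theorem pieces_of_crux (h : DilatedTableChowla) (m : ℕ) :
    OpNormPeriodicShortSide m ∧ OpNormBalancedShortSide m :=
  pieces_of_operatorNormForm (Theorems.TableChowla.Negative.operatorNormForm_of_tableChowla
    (Theorems.LargeDilatedTableChowla.dilatedTableChowla_iff_table_and_item.mp h).1) m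

/-! ## §3 What `closes` actually consumes of X1 -/

/-- X1 at ONE exponent `C₀` and NEGATIVE shifts only (`c ≤ −1`, i.e. `c = −h`, `h ≥ 1`): the exact strength
of `DilatedTableChowla` that the landed deciding chain `closes ← EngineToPairs_of ← SieveToMAvg_proof ←
core_of_cruxes` draws on (`core_of_cruxes` instantiates `hD (−h) _ δ _ _ (4·16421) _` once). -/
def ConsumedDilatedTableChowla (C₀ : ℝ) : Prop :=
  ∀ c : ℤ, c < 0 → ∀ δ : ℝ, 0 < δ → δ ≤ 1 / 12 → ∃ x₀ : ℝ, ∀ x : ℝ, x₀ ≤ x →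
    ∀ A : ℝ, x ^ δ ≤ A → A ≤ x ^ (1 / 3 + δ) → ∀ u v : ℕ → ℕ,
      (∑ q ∈ Finset.Icc 1 ⌊x ^ (δ / 2)⌋₊, (q : ℝ) ^ 3 *
        ∑ a ∈ (Finset.Ioc ⌊A⌋₊ ⌊2 * A⌋₊).filter (fun a : ℕ => a ≡ u q [MOD q]),
          ∑ a' ∈ (Finset.Ioc ⌊A⌋₊ ⌊2 * A⌋₊).filter (fun a' : ℕ => a' ≡ u q [MOD q]),
            (∑ b ∈ (Finset.Icc 1 ⌊x / A⌋₊).filter (fun b : ℕ => b ≡ v q [MOD q]),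
              (ArithmeticFunction.liouville (Int.toNat ((a : ℤ) * b + c)) : ℝ) *
                (ArithmeticFunction.liouville (Int.toNat ((a' : ℤ) * b + c)) : ℝ)) ^ 2) ≤
      x ^ 2 / Real.log x ^ C₀

/-- The glue's exponent `C₀ = 4 · 16421 = 65684` (`Theorems.SieveToMAvg.core_of_cruxes`). -/
def glueExponent : ℝ := ((4 * 16421 : ℕ) : ℝ)

theorem glueExponent_eq : glueExponent = 65684 := by unfold glueExponent; norm_num

/-- Trivial direction: the crux gives its consumed form at every exponent. -/
theorem consumed_of_crux (h : DilatedTableChowla) {C₀ : ℝ} (hC : 0 < C₀) : ConsumedDilatedTableChowla C₀ :=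
  fun c hc δ hδ hδ' => h c (ne_of_lt hc) δ hδ hδ' C₀ hC

open Theorems.SieveToMAvg in
/-- **The core bound from the CONSUMED form** (verbatim re-run of `Theorems.SieveToMAvg.core_of_cruxes` with
`hD` weakened to one exponent and negative shifts). -/
theorem core_of_consumed (hD : ConsumedDilatedTableChowla glueExponent) (hI : TypeI2Dilated) {h : ℕ}
    (hh : 1 ≤ h) :
    ∃ δ : ℝ, 0 < δ ∧ δ ≤ 1 / 12 ∧
      ∀ᶠ Y : ℝ in atTop, ∀ Q : ℕ, (Q : ℝ) ≤ Y ^ (δ / 4) → CoreSum h Q Y ≤ Y / Real.log Y ^ 6 := by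
  have hc : (-(h : ℤ)) ≠ 0 := by omega
  have hcneg : (-(h : ℤ)) < 0 := by omega
  obtain ⟨ρ, hρ, hfam⟩ := hI (-(h : ℤ)) hc
  set δ : ℝ := min (ρ / 4) (1 / 12) with hδdef
  have hδ : 0 < δ := lt_min (by positivity) (by norm_num)
  have hδ12 : δ ≤ 1 / 12 := min_le_right _ _
  have hδρ : 4 * δ ≤ ρ := by
    have := min_le_left (ρ / 4) (1 / 12); rw [← hδdef] at this; linarith
  -- Type I₂ (unchanged)
  have hApos : (0 : ℝ) < ((2 * 20536 : ℕ) : ℝ) := by norm_num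
  obtain ⟨C₂, x₀I, hI2⟩ := hfam _ hApos
  have hI2ev : ∀ᶠ Y : ℝ in atTop, HypI2 Y (-(h : ℤ)) h ρ (((2 * 20536 : ℕ) : ℝ)) (max C₂ 0) := by
    filter_upwards [Filter.eventually_ge_atTop x₀I, Filter.eventually_ge_atTop (1 : ℝ)] with Y hY hY1
    intro R S y hR hRx hS hSR hy hyx
    refine (hI2 Y hY h R S y hR hRx hS hSR hy hyx).trans ?_
    have : 0 ≤ Y / Real.log Y ^ (((2 * 20536 : ℕ) : ℝ)) :=
      div_nonneg (by linarith) (Real.rpow_nonneg (Real.log_nonneg hY1) _)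
    calc C₂ * Y / Real.log Y ^ (((2 * 20536 : ℕ) : ℝ))
        = C₂ * (Y / Real.log Y ^ (((2 * 20536 : ℕ) : ℝ))) := by ring
      _ ≤ max C₂ 0 * (Y / Real.log Y ^ (((2 * 20536 : ℕ) : ℝ))) :=
          mul_le_mul_of_nonneg_right (le_max_left _ _) this
      _ = max C₂ 0 * Y / Real.log Y ^ (((2 * 20536 : ℕ) : ℝ)) := by ring
  -- Type II from the consumed form: one exponent, one negative shift
  obtain ⟨x₀II, hII⟩ := hD (-(h : ℤ)) hcneg δ hδ hδ12
  have hIIev : ∀ᶠ Y : ℝ in atTop, HypII Y (-(h : ℤ)) δ (((4 * 16421 : ℕ) : ℝ)) := by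
    filter_upwards [Filter.eventually_ge_atTop x₀II] with Y hY
    exact fun A hA1 hA2 u v => hII Y hY A hA1 hA2 u v
  exact ⟨δ, hδ, hδ12, core_eventually hh hδ hδ12 hδρ (le_max_right C₂ 0) hIIev hI2ev⟩

open Theorems.SieveToMAvg in
/-- **`MAvg` from the consumed form** (verbatim re-run of `Theorems.SieveToMAvg.SieveToMAvg_proof`): the
terminal parity node follows from X1 at the single exponent `65684`, negative shifts, and X2.  Hence neither
the `∀ C` nor the shifts `c ≥ 1` of `DilatedTableChowla` are load-bearing for the route's `closes`. -/
theorem mavg_of_consumed (hD : ConsumedDilatedTableChowla glueExponent) (hI : TypeI2Dilated) : MAvg := by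
  intro h hh
  obtain ⟨δ, hδ, hδ12, hcore⟩ := core_of_consumed hD hI hh
  refine ⟨δ / 8, by positivity, ?_⟩
  show (fun x : ℝ => MAvgSum h (δ / 8) x) =o[atTop] fun x : ℝ => x
  have hev := MAvgSum_le_eventually hh hδ hδ12 hcore
  refine Asymptotics.isLittleO_iff.2 fun c hc => ?_
  have hlog : Tendsto (fun x : ℝ => Real.log x) atTop atTop := Real.tendsto_log_atTop
  filter_upwards [hev, hlog.eventually_ge_atTop c⁻¹, Filter.eventually_gt_atTop (0 : ℝ)] with x hx hL hx0
  have hL0 : 0 < Real.log x := lt_of_lt_of_le (inv_pos.2 hc) hL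
  rw [Real.norm_eq_abs, Real.norm_eq_abs, abs_of_nonneg (MAvgSum_nonneg h _ x), abs_of_pos hx0]
  refine hx.trans ?_
  rw [div_le_iff₀ hL0]
  calc x = c * x * c⁻¹ := by field_simp
    _ ≤ c * x * Real.log x := mul_le_mul_of_nonneg_left hL (by positivity)

/-- So the route's unconditional parity half reads, at its true strength:
`ConsumedDilatedTableChowla 65684 → TypeI2Dilated → MAvg`. -/
theorem parityHalf_consumed : ConsumedDilatedTableChowla glueExponent → TypeI2Dilated → MAvg :=
  mavg_of_consumed

end

end Summit.Parity.GeneralizedHardyLittlewood.Cruxes.DilatedTableChowla.StrategyCensusR1
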